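import Summits.KontsevichZagierPeriods.KontsevichZagierPeriods.Theses.SymplecticScissors
import Literature.ModelTheory.ExponentialFields.CylindricalDecomposition

/-!
# Signed sweep of the triangle, helper IV: sections over a strip

Helper file for the stub `stub_signedSweep` of the line `twist-restoring-shear` (crux
`PlanarCompiler`, route `SymplecticScissors`). Over an open strip `(u, v) ⊆ (0, 1)` we are given
the sections `ξ₀ < ⋯ < ξ_{n-1}` of a cylindrical decomposition whose graphs and bands cover the
vertical fibres and are adapted to the open triangle `T` (each band / graph lies in `T` or misses
it). We locate the two sections bounding `T`: `ξ_{j₀} = 0` and `ξ_{j₁} = 1 - t` identically on the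
strip, and every band strictly between them lies in `T` (elementary fibre arguments with the
extended-real band boundaries `bandLower`, `bandUpper`).
-/

noncomputable section

open MeasureTheory Set Filter Topology
open Literature.NumberTheory.Transcendental Literature.ModelTheory.ExponentialFields

namespace Summit.KontsevichZagierPeriods.SymplecticScissors.PlanarCompilerProof

variable {n : ℕ}

/-! ### Fibre helpers for bands -/

/-- Room above a point strictly below the upper boundary of a band. [folklore] -/
theorem exists_gt_lt_bandUpper {ξ : Fin n → (Fin 1 → ℝ) → ℝ} (j : Fin (n + 1)) (z : Fin 1 → ℝ)
    {t : ℝ} (ht : (t : EReal) < bandUpper ξ j z) :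
    ∃ b : ℝ, t < b ∧ ∀ s : ℝ, s < b → (s : EReal) < bandUpper ξ j z := by
  by_cases hl : j = Fin.last n
  · subst hl
    refine ⟨t + 1, lt_add_one t, fun s _ => ?_⟩
    rw [bandUpper_last]; exact EReal.coe_lt_top s
  · rw [bandUpper_of_ne_last ξ j hl] at ht ⊢
    exact ⟨ξ (j.castPred hl) z, EReal.coe_lt_coe_iff.1 ht, fun s hs => EReal.coe_lt_coe_iff.2 hs⟩

/-- Room below a point strictly above the lower boundary of a band. [folklore] -/
theorem exists_lt_bandLower_lt {ξ : Fin n → (Fin 1 → ℝ) → ℝ} (j : Fin (n + 1)) (z : Fin 1 → ℝ)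
    {t : ℝ} (ht : bandLower ξ j z < (t : EReal)) :
    ∃ a : ℝ, a < t ∧ ∀ s : ℝ, a < s → bandLower ξ j z < (s : EReal) := by
  by_cases h0 : j = 0
  · subst h0
    refine ⟨t - 1, sub_one_lt t, fun s _ => ?_⟩
    rw [bandLower_zero]; exact EReal.bot_lt_coe s
  · rw [bandLower_of_ne_zero ξ j h0] at ht ⊢
    exact ⟨ξ (j.pred h0) z, EReal.coe_lt_coe_iff.1 ht, fun s hs => EReal.coe_lt_coe_iff.2 hs⟩

/-- A section lies strictly below the upper boundary of the band just above it. [folklore] -/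
theorem coe_lt_bandUpper_succ {ξ : Fin n → (Fin 1 → ℝ) → ℝ} {z : Fin 1 → ℝ}
    (hmono : StrictMono fun j => ξ j z) (j : Fin n) :
    ((ξ j z : ℝ) : EReal) < bandUpper ξ j.succ z := by
  by_cases hl : j.succ = Fin.last n
  · rw [hl, bandUpper_last]; exact EReal.coe_lt_top _
  · rw [bandUpper_of_ne_last ξ _ hl, EReal.coe_lt_coe_iff]
    refine hmono (Fin.lt_def.2 ?_)
    rw [Fin.coe_castPred, Fin.val_succ]; exact Nat.lt_succ_self _

/-- A section lies strictly above the lower boundary of the band just below it. [folklore] -/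
theorem bandLower_castSucc_lt_coe {ξ : Fin n → (Fin 1 → ℝ) → ℝ} {z : Fin 1 → ℝ}
    (hmono : StrictMono fun j => ξ j z) (j : Fin n) :
    bandLower ξ j.castSucc z < ((ξ j z : ℝ) : EReal) := by
  by_cases h0 : j.castSucc = 0
  · rw [h0, bandLower_zero]; exact EReal.bot_lt_coe _
  · rw [bandLower_of_ne_zero ξ _ h0, EReal.coe_lt_coe_iff]
    refine hmono (Fin.lt_def.2 ?_)
    rw [Fin.val_pred, Fin.val_castSucc]
    have : (j : ℕ) ≠ 0 := fun h => h0 (Fin.ext (by simp [h]))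
    omega

/-! ### The two bounding sections of the triangle over a strip -/

/-- **Bounding sections.** Over a strip `(u, v) ⊆ (0, 1)`, sections `ξ₀ < ⋯ < ξ_{n-1}` whose graphs
and bands cover the fibres and are adapted to the open triangle `T` contain the bottom edge
`ξ_{j₀} = 0` and the hypotenuse `ξ_{j₁} = 1 - t` of `T` as sections, and every band strictly
between them lies in `T`. [folklore] -/
theorem stub_signedSweep_stripSections :
    ∀ {n : ℕ} {u v : ℝ}, 0 ≤ u → u < v → v ≤ 1 → ∀ {ξ : Fin n → (Fin 1 → ℝ) → ℝ},
    (∀ z : Fin 1 → ℝ, z 0 ∈ Ioo u v → StrictMono fun j => ξ j z) →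
    (∀ z : Fin 1 → ℝ, z 0 ∈ Ioo u v → ∀ t : ℝ,
      (∃ j, t = ξ j z) ∨ ∃ j : Fin (n + 1), bandLower ξ j z < (t : EReal) ∧ (t : EReal) < bandUpper ξ j z) →
    (∀ j : Fin (n + 1),
      bandOver {z : Fin 1 → ℝ | z 0 ∈ Ioo u v} ξ j ⊆ {p : Fin 2 → ℝ | 0 < p 0 ∧ 0 < p 1 ∧ p 0 + p 1 < 1} ∨
      Disjoint (bandOver {z : Fin 1 → ℝ | z 0 ∈ Ioo u v} ξ j) {p : Fin 2 → ℝ | 0 < p 0 ∧ 0 < p 1 ∧ p 0 + p 1 < 1}) →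
    (∀ j : Fin n,
      graphOver {z : Fin 1 → ℝ | z 0 ∈ Ioo u v} (ξ j) ⊆ {p : Fin 2 → ℝ | 0 < p 0 ∧ 0 < p 1 ∧ p 0 + p 1 < 1} ∨
      Disjoint (graphOver {z : Fin 1 → ℝ | z 0 ∈ Ioo u v} (ξ j)) {p : Fin 2 → ℝ | 0 < p 0 ∧ 0 < p 1 ∧ p 0 + p 1 < 1}) →
    ∃ j0 j1 : Fin n, j0 < j1 ∧ (∀ z : Fin 1 → ℝ, z 0 ∈ Ioo u v → ξ j0 z = 0) ∧
      (∀ z : Fin 1 → ℝ, z 0 ∈ Ioo u v → ξ j1 z = 1 - z 0) ∧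
      ∀ j : Fin (n + 1), j0.succ ≤ j → j ≤ j1.castSucc →
        bandOver {z : Fin 1 → ℝ | z 0 ∈ Ioo u v} ξ j ⊆ {p : Fin 2 → ℝ | 0 < p 0 ∧ 0 < p 1 ∧ p 0 + p 1 < 1} := by
  intro n u v hu huv hv ξ hmono hpart hTb hTg
  set S' : Set (Fin 1 → ℝ) := {z : Fin 1 → ℝ | z 0 ∈ Ioo u v} with hS'
  set T : Set (Fin 2 → ℝ) := {p : Fin 2 → ℝ | 0 < p 0 ∧ 0 < p 1 ∧ p 0 + p 1 < 1} with hT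
  -- membership of vertical points in `T`
  have memT : ∀ (z : Fin 1 → ℝ) (t : ℝ), (Fin.snoc z t : Fin 2 → ℝ) ∈ T ↔
      0 < z 0 ∧ 0 < t ∧ z 0 + t < 1 := fun z t => Iff.rfl
  have h01 : ∀ z : Fin 1 → ℝ, z 0 ∈ Ioo u v → 0 < z 0 ∧ z 0 < 1 := fun z hz =>
    ⟨hu.trans_lt hz.1, hz.2.trans_le hv⟩
  -- a band containing a point of `T` lies in `T`
  have band_sub : ∀ (j : Fin (n + 1)) (z : Fin 1 → ℝ) (t : ℝ), z 0 ∈ Ioo u v →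
      bandLower ξ j z < (t : EReal) → (t : EReal) < bandUpper ξ j z → (Fin.snoc z t : Fin 2 → ℝ) ∈ T →
      bandOver S' ξ j ⊆ T := by
    intro j z t hz h1 h2 ht
    rcases hTb j with h | h
    · exact h
    · exact absurd ht (Set.disjoint_left.1 h (snoc_mem_bandOver_iff.2 ⟨hz, h1, h2⟩))
  -- the base point
  set z₀ : Fin 1 → ℝ := fun _ => (u + v) / 2 with hz₀
  have hz₀S : z₀ 0 ∈ Ioo u v := ⟨by simp [hz₀]; linarith, by simp [hz₀]; linarith⟩
  have ha := h01 z₀ hz₀S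
  -- the bottom point `(a, 0)` lies on a graph
  obtain ⟨j0, hj0⟩ : ∃ j0 : Fin n, (0 : ℝ) = ξ j0 z₀ := by
    rcases hpart z₀ hz₀S 0 with h | ⟨j, hlow, hup⟩
    · exact h
    · exfalso
      obtain ⟨b, hb0, hb⟩ := exists_gt_lt_bandUpper j z₀ hup
      set t₁ := min b (1 - z₀ 0) / 2 with ht₁
      have ht₁0 : 0 < t₁ := by
        have : 0 < min b (1 - z₀ 0) := lt_min hb0 (by linarith [ha.2])
        rw [ht₁]; linarith
      have ht₁b : t₁ < b := by
        have := min_le_left b (1 - z₀ 0); rw [ht₁]; linarith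
      have ht₁a : z₀ 0 + t₁ < 1 := by
        have := min_le_right b (1 - z₀ 0); rw [ht₁]; linarith
      have hsub := band_sub j z₀ t₁ hz₀S (hlow.trans (EReal.coe_lt_coe_iff.2 ht₁0)) (hb t₁ ht₁b)
        ((memT z₀ t₁).2 ⟨ha.1, ht₁0, ht₁a⟩)
      have h0mem : (Fin.snoc z₀ 0 : Fin 2 → ℝ) ∈ bandOver S' ξ j :=
        snoc_mem_bandOver_iff.2 ⟨hz₀S, hlow, hup⟩
      have := ((memT z₀ 0).1 (hsub h0mem)).2.1
      exact lt_irrefl _ this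
  -- the top point `(a, 1 - a)` lies on a graph
  obtain ⟨j1, hj1⟩ : ∃ j1 : Fin n, 1 - z₀ 0 = ξ j1 z₀ := by
    rcases hpart z₀ hz₀S (1 - z₀ 0) with h | ⟨j, hlow, hup⟩
    · exact h
    · exfalso
      obtain ⟨a', ha', halow⟩ := exists_lt_bandLower_lt j z₀ hlow
      set t₂ := (max a' 0 + (1 - z₀ 0)) / 2 with ht₂
      have hm : max a' 0 < 1 - z₀ 0 := max_lt ha' (by linarith [ha.2])
      have ht₂0 : 0 < t₂ := by
        have := le_max_right a' 0; rw [ht₂]; linarith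
      have ht₂a' : a' < t₂ := by
        have := le_max_left a' 0; rw [ht₂]; linarith
      have ht₂1 : z₀ 0 + t₂ < 1 := by rw [ht₂]; linarith
      have ht₂lt : t₂ < 1 - z₀ 0 := by rw [ht₂]; linarith
      have hsub := band_sub j z₀ t₂ hz₀S (halow t₂ ht₂a')
        ((EReal.coe_lt_coe_iff.2 ht₂lt).trans hup) ((memT z₀ t₂).2 ⟨(h01 z₀ hz₀S).1, ht₂0, ht₂1⟩)
      have h1mem : (Fin.snoc z₀ (1 - z₀ 0) : Fin 2 → ℝ) ∈ bandOver S' ξ j :=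
        snoc_mem_bandOver_iff.2 ⟨hz₀S, hlow, hup⟩
      have := ((memT z₀ (1 - z₀ 0)).1 (hsub h1mem)).2.2
      linarith
  have hj01 : j0 < j1 := by
    rw [← (hmono z₀ hz₀S).lt_iff_lt, ← hj0, ← hj1]; linarith [ha.2]
  -- bands strictly between `ξ_{j0}` and `ξ_{j1}` lie in `T`
  have hbetween : ∀ j : Fin (n + 1), j0.succ ≤ j → j ≤ j1.castSucc → bandOver S' ξ j ⊆ T := by
    intro j hj hj'
    have hjv : (j0 : ℕ) + 1 ≤ j := by simpa [Fin.le_def] using hj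
    have hjv' : (j : ℕ) ≤ j1 := by simpa [Fin.le_def] using hj'
    have hne0 : j ≠ 0 := fun h => by rw [h] at hjv; simp at hjv
    have hnel : j ≠ Fin.last n := fun h => by
      rw [h, Fin.val_last] at hjv'; exact absurd hjv' (not_le.2 j1.isLt)
    have hlowle : ξ j0 z₀ ≤ ξ (j.pred hne0) z₀ := by
      refine (hmono z₀ hz₀S).monotone (Fin.le_def.2 ?_)
      rw [Fin.val_pred]; omega
    have huple : ξ (j.castPred hnel) z₀ ≤ ξ j1 z₀ := by
      refine (hmono z₀ hz₀S).monotone (Fin.le_def.2 ?_)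
      rw [Fin.coe_castPred]; exact hjv'
    have hlt : ξ (j.pred hne0) z₀ < ξ (j.castPred hnel) z₀ := by
      refine hmono z₀ hz₀S (Fin.lt_def.2 ?_)
      rw [Fin.val_pred, Fin.coe_castPred]; omega
    set m := (ξ (j.pred hne0) z₀ + ξ (j.castPred hnel) z₀) / 2 with hm
    have hm1 : ξ (j.pred hne0) z₀ < m := by rw [hm]; linarith
    have hm2 : m < ξ (j.castPred hnel) z₀ := by rw [hm]; linarith
    refine band_sub j z₀ m hz₀S ?_ ?_ ((memT z₀ m).2 ⟨ha.1, ?_, ?_⟩)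
    · rw [bandLower_of_ne_zero ξ j hne0]; exact EReal.coe_lt_coe_iff.2 hm1
    · rw [bandUpper_of_ne_last ξ j hnel]; exact EReal.coe_lt_coe_iff.2 hm2
    · linarith [hj0]
    · linarith [hj1]
  have hsucc_le : j0.succ ≤ j1.castSucc := by
    rw [Fin.le_def, Fin.val_succ, Fin.val_castSucc]; exact Fin.lt_def.1 hj01
  refine ⟨j0, j1, hj01, fun z hz => ?_, fun z hz => ?_, hbetween⟩
  · -- `ξ_{j0} = 0` on the strip
    have hc := h01 z hz
    have hE : bandOver S' ξ j0.succ ⊆ T := hbetween _ le_rfl hsucc_le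
    have hD : Disjoint (graphOver S' (ξ j0)) T := by
      rcases hTg j0 with h | h
      · exfalso
        have hmem : (Fin.snoc z₀ 0 : Fin 2 → ℝ) ∈ graphOver S' (ξ j0) :=
          snoc_mem_graphOver_iff.2 ⟨hz₀S, hj0⟩
        exact lt_irrefl _ ((memT z₀ 0).1 (h hmem)).2.1
      · exact h
    obtain ⟨b, hb, hbup⟩ := exists_gt_lt_bandUpper j0.succ z (coe_lt_bandUpper_succ (hmono z hz) j0)
    have hfib : ∀ s : ℝ, ξ j0 z < s → s < b → 0 < s ∧ z 0 + s < 1 := by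
      intro s hs1 hs2
      have hmem : (Fin.snoc z s : Fin 2 → ℝ) ∈ bandOver S' ξ j0.succ := by
        refine snoc_mem_bandOver_iff.2 ⟨hz, ?_, hbup s hs2⟩
        rw [bandLower_succ]; exact EReal.coe_lt_coe_iff.2 hs1
      have := (memT z s).1 (hE hmem)
      exact ⟨this.2.1, this.2.2⟩
    have hge : 0 ≤ ξ j0 z := by
      by_contra hneg
      rw [not_le] at hneg
      have h1 : ξ j0 z < (ξ j0 z + min 0 b) / 2 := by
        have := lt_min hneg hb; linarith
      have h2 : (ξ j0 z + min 0 b) / 2 < b := by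
        have := min_le_right 0 b; have := lt_min hneg hb; linarith
      have h3 : (ξ j0 z + min 0 b) / 2 < 0 := by
        have := min_le_left 0 b; linarith
      exact absurd (hfib _ h1 h2).1 (not_lt.2 h3.le)
    have hlt1 : ξ j0 z < 1 - z 0 := by
      have := hfib ((ξ j0 z + b) / 2) (by linarith) (by linarith)
      linarith
    have hle : ξ j0 z ≤ 0 := by
      by_contra hpos
      rw [not_le] at hpos
      have hmem : (Fin.snoc z (ξ j0 z) : Fin 2 → ℝ) ∈ graphOver S' (ξ j0) :=
        snoc_mem_graphOver_iff.2 ⟨hz, rfl⟩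
      exact Set.disjoint_left.1 hD hmem ((memT z _).2 ⟨hc.1, hpos, by linarith⟩)
    exact le_antisymm hle hge
  · -- `ξ_{j1} = 1 - t` on the strip
    have hc := h01 z hz
    have hE : bandOver S' ξ j1.castSucc ⊆ T := hbetween _ hsucc_le le_rfl
    have hD : Disjoint (graphOver S' (ξ j1)) T := by
      rcases hTg j1 with h | h
      · exfalso
        have hmem : (Fin.snoc z₀ (1 - z₀ 0) : Fin 2 → ℝ) ∈ graphOver S' (ξ j1) :=
          snoc_mem_graphOver_iff.2 ⟨hz₀S, hj1⟩
        have := ((memT z₀ _).1 (h hmem)).2.2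
        linarith
      · exact h
    obtain ⟨a', ha', halow⟩ := exists_lt_bandLower_lt j1.castSucc z (bandLower_castSucc_lt_coe (hmono z hz) j1)
    have hfib : ∀ s : ℝ, a' < s → s < ξ j1 z → 0 < s ∧ z 0 + s < 1 := by
      intro s hs1 hs2
      have hmem : (Fin.snoc z s : Fin 2 → ℝ) ∈ bandOver S' ξ j1.castSucc := by
        refine snoc_mem_bandOver_iff.2 ⟨hz, halow s hs1, ?_⟩
        rw [bandUpper_castSucc]; exact EReal.coe_lt_coe_iff.2 hs2
      have := (memT z s).1 (hE hmem)
      exact ⟨this.2.1, this.2.2⟩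
    have hle : ξ j1 z ≤ 1 - z 0 := by
      by_contra hgt
      rw [not_le] at hgt
      have hm : max a' (1 - z 0) < ξ j1 z := max_lt ha' hgt
      have h1 : a' < (max a' (1 - z 0) + ξ j1 z) / 2 := by
        have := le_max_left a' (1 - z 0); linarith
      have h2 : (max a' (1 - z 0) + ξ j1 z) / 2 < ξ j1 z := by linarith
      have h3 : 1 - z 0 < (max a' (1 - z 0) + ξ j1 z) / 2 := by
        have := le_max_right a' (1 - z 0); linarith
      have := (hfib _ h1 h2).2
      linarith
    have hpos : 0 < ξ j1 z := by
      have := hfib ((a' + ξ j1 z) / 2) (by linarith) (by linarith)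
      linarith
    have hge : 1 - z 0 ≤ ξ j1 z := by
      by_contra hlt
      rw [not_le] at hlt
      have hmem : (Fin.snoc z (ξ j1 z) : Fin 2 → ℝ) ∈ graphOver S' (ξ j1) :=
        snoc_mem_graphOver_iff.2 ⟨hz, rfl⟩
      exact Set.disjoint_left.1 hD hmem ((memT z _).2 ⟨hc.1, hpos, by linarith⟩)
    exact le_antisymm hle hge

end Summit.KontsevichZagierPeriods.SymplecticScissors.PlanarCompilerProof
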